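import Literature.Topology.CoveringSpaces.UniversalCoverLift
import Literature.Topology.CoveringSpaces.UniversalCoverGroupKernel
import Literature.Geometry.Kaehler.RiemannSurfaceStructurePullback
import Literature.AlgebraicTopology.Homotopy.ManifoldStronglyLocallyContractible
import HarnessLib

/-!
# The holomorphic universal covering of a connected Riemann surface

Topic `Literature/Geometry/Kaehler` (PROOF-ONLY; no definitions).  O. Forster, *Lectures on Riemann
Surfaces*, GTM 81 (1981), §4 Thm. 4.6 with §5 Thm. 5.9 / I-Hsiung Lin, *Classical complex analysis: a
geometric approach*, vol. 2 (2011), (7.5.2.1) p. 449 and §7.5.3: «every connected Riemann surface `X`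
has a universal covering `p : X̃ → X`; `X̃` carries a unique complex structure making `p` locally
biholomorphic, and the covering transformations are biholomorphic».  This is the OBJECT over which
the uniformization theorem (Tier 2 of the abc-iut programme «UNIF»: `X ≅ X̃/π₁(X)` with
`X̃ ∈ {𝔻, ℂ, ℙ¹}`) quantifies; this file PRODUCES it from the tree's assets, proving everything:

* the topological hypotheses of the covering-space library at a connected Riemann surface —
  `pathConnectedSpace_of_connectedSpace` (Mathlib: charted spaces over a locally path connected model
  are locally path connected) and `stronglyLocallyContractibleSpace_of_riemannSurface` (the tree's
  `stronglyLocallyContractibleSpace_of_chartedSpace_normedSpace`);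
* the CONCRETE MODEL: Hatcher's universal cover `UniversalCover X x₀` of the tree
  (`Literature/Topology/CoveringSpaces/UniversalCover*.lean`: a simply connected Hausdorff covering
  space on which `π₁(X, x₀)` acts by deck transformations) with the complex structure PULLED BACK along
  the covering projection (`IsLocalHomeomorph.comapChartedSpace`, abc-iut-L4-t12's
  `RiemannSurfaceStructurePullback`): `UniversalCover.isManifold_comap`,
  `UniversalCover.mdifferentiable_proj`, `UniversalCover.isLocalDiffeomorph_proj`,
  `UniversalCover.mdifferentiable_of_proj_comp_eq` (deck transformations are holomorphic),
  `UniversalCover.mdifferentiable_smul` (the `π₁`-translates are holomorphic);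
* the generic lemma behind the last two: `mdifferentiable_of_comp_eq_of_isLocalDiffeomorph` — a
  continuous self-map `γ` of the total space of a holomorphic local biholomorphism `u` with
  `u ∘ γ = u` is holomorphic (locally `γ = u⁻¹ ∘ u`);
* the `∃`-PACKAGE `exists_simplyConnected_holomorphic_cover`: every connected Riemann surface admits a
  surjective holomorphic covering map from a simply connected Hausdorff Riemann surface which is a local
  biholomorphism and all of whose deck transformations are biholomorphic.

Classical support for the abc-iut cell's campaign L (programme «UNIF», L4-t8 SPINE RULING #2, brick B4);
nothing here bears on [IUTchIII] Cor. 3.12.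

## References
* [Forster1981] O. Forster, Lectures on Riemann Surfaces, GTM 81 (1981), §4 Thm. 4.6, §5 Thm. 5.9.
* [Lin2011] I-Hsiung Lin, Classical complex analysis: a geometric approach, vol. 2 (2011), (7.5.2.1)
  p. 449, §7.5.3.
* [HatcherAT2002] A. Hatcher, Algebraic Topology (2002), §1.3 pp. 63–70.
-/

noncomputable section

open Set Function Filter Topology TopologicalSpace
open scoped Manifold ContDiff Topology

namespace Literature.Geometry.Kaehler

open Literature.Topology.CoveringSpaces Literature.AlgebraicTopology.Homotopy

universe u

/-! ### Deck-type maps of a holomorphic local biholomorphism are holomorphic -/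

section Deck

variable {X : Type*} [TopologicalSpace X] [ChartedSpace ℂ X]
  {Y : Type*} [TopologicalSpace Y] [ChartedSpace ℂ Y] {u : Y → X}

/-- **A continuous map over a holomorphic local biholomorphism is holomorphic**: if `u : Y → X` is a
holomorphic local `C^ω`-diffeomorphism between spaces charted over `ℂ` and `γ : Y → Y` is continuous
with `u ∘ γ = u`, then `γ` is holomorphic — near each point `γ = Φ⁻¹ ∘ u` for the local inverse `Φ⁻¹`
of `u` at `γ y` (Forster §4: «covering transformations are biholomorphic»).
[cite: Forster1981, §4 Thm. 4.6] -/
theorem mdifferentiable_of_comp_eq_of_isLocalDiffeomorph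
    (hu : IsLocalDiffeomorph 𝓘(ℂ, ℂ) 𝓘(ℂ, ℂ) ω u) (hud : MDifferentiable 𝓘(ℂ, ℂ) 𝓘(ℂ, ℂ) u)
    {γ : Y → Y} (hγc : Continuous γ) (hγ : ∀ y, u (γ y) = u y) :
    MDifferentiable 𝓘(ℂ, ℂ) 𝓘(ℂ, ℂ) γ := by
  intro y
  obtain ⟨Φ, hyΦ, heq⟩ := hu (γ y)
  -- near `y`, `γ = Φ⁻¹ ∘ u`
  have hnear : ∀ᶠ w in 𝓝 y, γ w ∈ Φ.source :=
    hγc.continuousAt.preimage_mem_nhds (Φ.open_source.mem_nhds hyΦ)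
  have hloc : (Φ.symm ∘ u) =ᶠ[𝓝 y] γ := by
    filter_upwards [hnear] with w hw
    simp only [Function.comp_apply]
    rw [← hγ w, heq hw]
    exact Φ.toPartialEquiv.left_inv hw
  have hsymm : MDifferentiableAt 𝓘(ℂ, ℂ) 𝓘(ℂ, ℂ) Φ.symm (u y) := by
    have hmem : u y ∈ Φ.symm.source := by
      rw [← hγ y, heq hyΦ]
      exact Φ.toPartialEquiv.map_source hyΦ
    exact Φ.symm.mdifferentiableAt (by simp) hmem
  exact (hsymm.comp y (hud y)).congr_of_eventuallyEq hloc.symm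

/-- The homeomorphism form: a self-homeomorphism `γ` of `Y` over `u` (`u ∘ γ = u`) is holomorphic with
holomorphic inverse. [cite: Forster1981, §4 Thm. 4.6] -/
theorem mdifferentiable_homeomorph_of_comp_eq_of_isLocalDiffeomorph
    (hu : IsLocalDiffeomorph 𝓘(ℂ, ℂ) 𝓘(ℂ, ℂ) ω u) (hud : MDifferentiable 𝓘(ℂ, ℂ) 𝓘(ℂ, ℂ) u)
    (γ : Y ≃ₜ Y) (hγ : ∀ y, u (γ y) = u y) :
    MDifferentiable 𝓘(ℂ, ℂ) 𝓘(ℂ, ℂ) γ ∧ MDifferentiable 𝓘(ℂ, ℂ) 𝓘(ℂ, ℂ) γ.symm := by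
  refine ⟨mdifferentiable_of_comp_eq_of_isLocalDiffeomorph hu hud γ.continuous hγ,
    mdifferentiable_of_comp_eq_of_isLocalDiffeomorph hu hud γ.symm.continuous fun y => ?_⟩
  conv_rhs => rw [← γ.apply_symm_apply y]
  exact (hγ (γ.symm y)).symm

end Deck

/-! ### Topological hypotheses of the covering library at a connected Riemann surface -/

section Hypotheses

variable (X : Type u) [TopologicalSpace X] [ChartedSpace ℂ X]

/-- A connected space charted over `ℂ` is path connected (charted spaces over a locally path connected
model are locally path connected). [cite: Forster1981, §5 Thm. 5.9 (proof)] -/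
theorem pathConnectedSpace_of_connectedSpace [ConnectedSpace X] : PathConnectedSpace X := by
  haveI := ChartedSpace.locallyPathConnectedSpace ℂ X
  exact pathConnectedSpace_iff_connectedSpace.2 ‹_›

/-- A space charted over `ℂ` is strongly locally contractible (it is a topological manifold;
Hatcher Cor. A.9). [cite: HatcherAT2002, §1.3 p. 63 (hypotheses of the universal cover)] -/
theorem stronglyLocallyContractibleSpace_of_riemannSurface : StronglyLocallyContractibleSpace X :=
  stronglyLocallyContractibleSpace_of_chartedSpace_normedSpace ℂ X

end Hypotheses

/-! ### The concrete model: Hatcher's universal cover with the pulled-back complex structure -/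

namespace UniversalCover

variable {X : Type u} [TopologicalSpace X] [ChartedSpace ℂ X] [ConnectedSpace X] (x₀ : X)

/-- The universal cover `X̃ → X` of a connected space charted over `ℂ` is a covering map (the tree's
`UniversalCover.isCoveringMap_proj`, its hypotheses discharged). [cite: HatcherAT2002, §1.3 p. 64] -/
theorem isCoveringMap_proj_riemannSurface :
    IsCoveringMap (UniversalCover.proj : UniversalCover X x₀ → X) := by
  haveI := pathConnectedSpace_of_connectedSpace X
  haveI := stronglyLocallyContractibleSpace_of_riemannSurface X
  exact UniversalCover.isCoveringMap_proj

/-- The universal cover `X̃ → X` of a connected space charted over `ℂ` is surjective.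
[cite: HatcherAT2002, §1.3 p. 64] -/
theorem proj_surjective_riemannSurface :
    Function.Surjective (UniversalCover.proj : UniversalCover X x₀ → X) := by
  haveI := pathConnectedSpace_of_connectedSpace X
  exact UniversalCover.proj_surjective

/-- The universal cover of a connected space charted over `ℂ` is simply connected.
[cite: HatcherAT2002, §1.3 p. 65] -/
theorem simplyConnectedSpace_riemannSurface : SimplyConnectedSpace (UniversalCover X x₀) := by
  haveI := pathConnectedSpace_of_connectedSpace X
  haveI := stronglyLocallyContractibleSpace_of_riemannSurface X
  infer_instance

/-- The universal cover of a connected Hausdorff space charted over `ℂ` is Hausdorff (Forster §5: the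
universal covering of a Riemann surface is a Riemann surface, in particular Hausdorff).
[cite: Forster1981, §5 Thm. 5.9] -/
theorem t2Space_riemannSurface [T2Space X] : T2Space (UniversalCover X x₀) := by
  haveI := pathConnectedSpace_of_connectedSpace X
  haveI := stronglyLocallyContractibleSpace_of_riemannSurface X
  exact UniversalCover.t2Space

variable [IsManifold 𝓘(ℂ, ℂ) ω X]

/-- **The universal cover of a connected Riemann surface is a Riemann surface** for the complex
structure pulled back along the projection (Forster 4.6 / Lin (7.5.2.1)).
[cite: Forster1981, §4 Thm. 4.6] [cite: Lin2011, (7.5.2.1) p. 449] -/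
theorem isManifold_comap :
    letI := IsLocalHomeomorph.comapChartedSpace ℂ (isCoveringMap_proj_riemannSurface x₀).isLocalHomeomorph;
    IsManifold 𝓘(ℂ, ℂ) ω (UniversalCover X x₀) :=
  (riemannSurface_of_isCoveringMap (isCoveringMap_proj_riemannSurface x₀)).1

/-- **The projection of the universal cover is holomorphic** for the pulled-back structure.
[cite: Forster1981, §4 Thm. 4.6] -/
theorem mdifferentiable_proj :
    letI := IsLocalHomeomorph.comapChartedSpace ℂ (isCoveringMap_proj_riemannSurface x₀).isLocalHomeomorph;
    MDifferentiable 𝓘(ℂ, ℂ) 𝓘(ℂ, ℂ) (UniversalCover.proj : UniversalCover X x₀ → X) :=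
  (riemannSurface_of_isCoveringMap (isCoveringMap_proj_riemannSurface x₀)).2.1

/-- **The projection of the universal cover is a local biholomorphism** for the pulled-back structure
(«`F` is then locally conformal»). [cite: Lin2011, (7.5.2.1) p. 449] -/
theorem isLocalDiffeomorph_proj :
    letI := IsLocalHomeomorph.comapChartedSpace ℂ (isCoveringMap_proj_riemannSurface x₀).isLocalHomeomorph;
    IsLocalDiffeomorph 𝓘(ℂ, ℂ) 𝓘(ℂ, ℂ) ω (UniversalCover.proj : UniversalCover X x₀ → X) :=
  (riemannSurface_of_isCoveringMap (isCoveringMap_proj_riemannSurface x₀)).2.2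

/-- **Deck transformations of the universal cover are biholomorphic** for the pulled-back structure:
every self-homeomorphism `γ` of `X̃` with `p ∘ γ = p` is holomorphic with holomorphic inverse
(Forster: «covering transformations are biholomorphic»). [cite: Forster1981, §4 Thm. 4.6] -/
theorem mdifferentiable_of_proj_comp_eq (γ : UniversalCover X x₀ ≃ₜ UniversalCover X x₀)
    (hγ : ∀ a, UniversalCover.proj (γ a) = UniversalCover.proj a) :
    letI := IsLocalHomeomorph.comapChartedSpace ℂ (isCoveringMap_proj_riemannSurface x₀).isLocalHomeomorph;
    MDifferentiable 𝓘(ℂ, ℂ) 𝓘(ℂ, ℂ) γ ∧ MDifferentiable 𝓘(ℂ, ℂ) 𝓘(ℂ, ℂ) γ.symm := by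
  letI := IsLocalHomeomorph.comapChartedSpace ℂ (isCoveringMap_proj_riemannSurface x₀).isLocalHomeomorph
  exact mdifferentiable_homeomorph_of_comp_eq_of_isLocalDiffeomorph (isLocalDiffeomorph_proj x₀)
    (mdifferentiable_proj x₀) γ hγ

/-- **The `π₁(X, x₀)`-translates of the universal cover are holomorphic** for the pulled-back
structure: for every `α ∈ π₁(X, x₀)` the deck action `a ↦ α • a` (Hatcher Prop. 1.39) is holomorphic,
and so is its inverse `a ↦ α⁻¹ • a`. [cite: Forster1981, §4 Thm. 4.6] [cite: HatcherAT2002, §1.3 Prop. 1.39] -/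
theorem mdifferentiable_smul (α : FundamentalGroup X x₀) :
    letI := IsLocalHomeomorph.comapChartedSpace ℂ (isCoveringMap_proj_riemannSurface x₀).isLocalHomeomorph;
    MDifferentiable 𝓘(ℂ, ℂ) 𝓘(ℂ, ℂ) (fun a : UniversalCover X x₀ => α • a) := by
  letI := IsLocalHomeomorph.comapChartedSpace ℂ (isCoveringMap_proj_riemannSurface x₀).isLocalHomeomorph
  exact mdifferentiable_of_comp_eq_of_isLocalDiffeomorph (isLocalDiffeomorph_proj x₀)
    (mdifferentiable_proj x₀) (continuous_const_smul α) (UniversalCover.proj_smul α)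

end UniversalCover

/-! ### The `∃`-package -/

/-- **Every connected Riemann surface has a holomorphic universal covering** (Forster 4.6 + 5.9, Lin
(7.5.2.1) / §7.5.3), packaged over an ANONYMOUS simply connected Riemann surface: there are a simply
connected Hausdorff Riemann surface `Ũ` and a surjective holomorphic covering map `u : Ũ → X` which is
a local biholomorphism and all of whose deck transformations are biholomorphic.  (Witness: Hatcher's
`UniversalCover X x₀` with the pulled-back structure.)  This is the object the uniformization theorem
`X ≅ Ũ/π₁(X)`, `Ũ ∈ {𝔻, ℂ, ℙ¹}`, quantifies over. [cite: Forster1981, §5 Thm. 5.9] -/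
theorem exists_simplyConnected_holomorphic_cover (X : Type u) [TopologicalSpace X] [T2Space X]
    [ConnectedSpace X] [ChartedSpace ℂ X] [IsManifold 𝓘(ℂ, ℂ) ω X] :
    ∃ (Ũ : Type u) (_ : TopologicalSpace Ũ) (_ : T2Space Ũ) (_ : SimplyConnectedSpace Ũ)
      (_ : ChartedSpace ℂ Ũ) (_ : IsManifold 𝓘(ℂ, ℂ) ω Ũ) (u : Ũ → X),
      IsCoveringMap u ∧ Function.Surjective u ∧ MDifferentiable 𝓘(ℂ, ℂ) 𝓘(ℂ, ℂ) u ∧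
      IsLocalDiffeomorph 𝓘(ℂ, ℂ) 𝓘(ℂ, ℂ) ω u ∧
      ∀ γ : Ũ ≃ₜ Ũ, (∀ y, u (γ y) = u y) →
        MDifferentiable 𝓘(ℂ, ℂ) 𝓘(ℂ, ℂ) γ ∧ MDifferentiable 𝓘(ℂ, ℂ) 𝓘(ℂ, ℂ) γ.symm := by
  obtain ⟨x₀⟩ := (inferInstance : Nonempty X)
  letI := IsLocalHomeomorph.comapChartedSpace ℂ
    (UniversalCover.isCoveringMap_proj_riemannSurface x₀).isLocalHomeomorph
  exact ⟨UniversalCover X x₀, inferInstance, UniversalCover.t2Space_riemannSurface x₀,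
    UniversalCover.simplyConnectedSpace_riemannSurface x₀, inferInstance,
    UniversalCover.isManifold_comap x₀, UniversalCover.proj,
    UniversalCover.isCoveringMap_proj_riemannSurface x₀, UniversalCover.proj_surjective_riemannSurface x₀,
    UniversalCover.mdifferentiable_proj x₀, UniversalCover.isLocalDiffeomorph_proj x₀,
    fun γ hγ => UniversalCover.mdifferentiable_of_proj_comp_eq x₀ γ hγ⟩

end Literature.Geometry.Kaehler

end
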